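import Summits.BirchSwinnertonDyer.BirchSwinnertonDyer.Theorems.EisensteinPrimesBSDpOnCellCTelescopeK2CohomologyTransfer
import Summits.BirchSwinnertonDyer.BirchSwinnertonDyer.Theorems.EisensteinPrimesBSDpOnCellCTelescopeK2BigRepTransfer
import Summits.BirchSwinnertonDyer.BirchSwinnertonDyer.Theorems.EisensteinPrimesBSDpOnCellCTelescopeK2SelmerScalarTransport
import Summits.BirchSwinnertonDyer.BirchSwinnertonDyer.Theorems.EisensteinPrimesBSDpOnCellCTelescopeK2TorsionBigRepIdentification
import Summits.BirchSwinnertonDyer.BirchSwinnertonDyer.Theorems.EisensteinPrimesBSDpOnCellCTelescopeK2QuasiIsoCharIdeal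
import Summits.BirchSwinnertonDyer.BirchSwinnertonDyer.Theorems.EisensteinPrimesBSDpOnCellCTelescopeK2WeightTwoTransportCore
import Summits.BirchSwinnertonDyer.BirchSwinnertonDyer.Theorems.BiquadraticEisensteinDescentEisensteinHeartFlatCMInertBadKPrimeCharIdealSlack
import Literature.NumberTheory.EllipticCurves.BigRepModuleCoeffExtension
import Literature.NumberTheory.EllipticCurves.IwasawaAlgebraSemilinearCharIdealProofs
import HarnessLib

/-!
# Crux 4 `BSDpOnCellC` (stmt-BirchSwinnertonDyer-19034), line «telescope», leaf N3′ `stub_memberControlMod` — THE MEMBER TRANSPORT CORE: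
# `Y = Sel_{𝔮,∅}(K, M[C c])^∨` (over `Λ = ℤ_p⟦T⟧`) versus `𝔛 = XBig κ ρ_C 𝔮 ∅` (over `R⟦T⟧`) along a quasi-isomorphism of coefficients
# `θ : A[c] → C` semilinear over a BIJECTIVE `ℤ_p → R` (helper, `--supports stmt-BirchSwinnertonDyer-19034`; closes nothing)

Cell `bsd-eis`, width seat `bsd-line-x2-p2` (prover g22, 2026-08-30; D-0154 KEY row 5). THEOREMS ONLY (no definition, no named fact, no
instance, no notation). HONEST FRAMING: no stub, no crux, no summit statement is proved; BSD is proved for no curve.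

SETTING (generic; in N3′: `𝒪 = ℤ_p⟦X⟧`, `A = A₂` of leaf N1, `c = X − C x_k`, `R = 𝒪_k = padicCoeffIntegers (D k).ι`, `C = Cofree (D k).Δ.selfDualRep _`,
`ρ_C = (D k).Δ.selfDualCofreeRepOver K`, `θ = θ_k` of N1's clause (fd_k), `𝔮 = 𝔭̄`): `𝒪`, `R` are `ℤ_p`-algebras, the structure map `ℤ_p → R`
is BIJECTIVE ((rat_k) gives surjectivity; `𝒪_k ⊂ ℚ̄_p` injectivity); `A` (resp. `C`) is a discrete `𝒪`- (resp. `R`-) module, `C` is `p`-primary;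
`θ : A[c] →+ C` satisfies `θ (r • a) = (algebraMap ℤ_p R r) • θ a`, is `Γ_K`-equivariant for `torsionRep ρ c` / `ρ_C`, and has FINITE kernel and
cokernel; `Y` carries ANY `Λ`-structure compatible with its `𝒪⟦T⟧`-structure (binders, as in the LEAD's `TelescopeK2WeightTwoTransportCore`);
`𝔛` carries its `R⟦T⟧`-structure for ANY admissible topology on `R⟦T⟧` (the binder of N3′).

* §1 scalar bookkeeping: finite generation / torsion along an additive equivalence semilinear over a ring ISOMORPHISM
  (`moduleFinite_of_semilinearEquiv`, `isTorsion_of_semilinearEquiv`; characteristic ideals: tree `Module.charIdeal_eq_map_of_semilinearEquiv`);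
  torsion along a linear map with kernel, resp. cokernel, killed by a non-zero-divisor (`isTorsion_of_ker_smul`, `isTorsion_of_smul_mem_range`).
* §2 `exists_dual_selmer_addEquiv_restrictScalars`: the Pontryagin duals of the Selmer groups of `bigRep κ (ρ_C|ℤ_p)` (a `Λ`-module) and of
  `bigRep κ ρ_C` (an `R⟦T⟧`-module) are identified, semilinearly over `PowerSeries.map (algebraMap ℤ_p R)` (`BigRepModule.restrictScalarsEquiv`
  + `TelescopeK2SelmerScalarTransport.exists_selmer_addEquiv`, dualised).
* §3 **`memberTransport`**: (i) `Module.IsTorsion R⟦T⟧ 𝔛 ↔ Module.IsTorsion Λ Y`; (ii) for `𝔛`, `Y` finitely generated and `Y` torsion,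
  `∃ e, (C (algebraMap ℤ_p R p^e)) · Ch_{R⟦T⟧}(𝔛) ⊆ (char_Λ Y).map (PowerSeries.map (algebraMap ℤ_p R))` — the DIRECTION of N3′'s (ctrl_k).
  PROOF: for the `ℤ_p`-structure `r • y := algebraMap r • y` on `C`, `θ` is `ℤ_p`-linear with kernel killed by `p^{e₁}` and cokernel by `p^{e₂}`;
  with the DISCRETE topology on `Λ`, brick p749312 gives `f : A[c] ⊗ Λ^* → C ⊗ Λ^*` for `ρ_C|ℤ_p`, brick p749172 the dual Selmer transfer
  `β : 𝔛_ℤ → Y''` (`ker β` killed by `(ab)²`, `ab • Y'' ⊆ range β`, `a = C p^{e₁}`, `b = C p^{e₂}`), bricks p749882 + p749591 `Y ≃ₗ[Λ] Y''`, §2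
  `𝔛_ℤ ≃ 𝔛` semilinear over `σ : Λ ≃+* R⟦T⟧`; (i) is §1 through `β`, (ii) is x2-p2 g19's `exists_span_pow_mul_charIdeal_le_of_smul_le_range` for `β`
  (COKERNEL bound), `char Y'' ⊆ char Y`, and `Ch_{R⟦T⟧}(𝔛) = σ(char_Λ 𝔛_ℤ)`.

Beyond this core N3′ needs (next file of this seat): the member control map `α : X₂/π_k X₂ → Y` (x2-p2 g21 p761336; ∀ᶠ k), finite generation of
`𝔛(g_k)` (tree `SkinnerUrban2014.moduleFinite_XBig`), `b ∘ algebraMap ℤ_p 𝒪_k = R1.toCpInt p`, and the vacuity of (ctrl_k) off the torsion locus.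

References: R. Greenberg, LNM 1716 (1999) §4 [GreenbergLNM1716]; C. Skinner, Pacific J. Math. 283 (2016) §2.3 p. 179 [Skinner2016PacificMC];
N. Bourbaki, AC VII §4.4–4.5 [BourbakiAC5to7]; F. Castella, Camb. J. Math. 6 (2018) §2.1–2.2 [Castella2018].
-/

set_option autoImplicit false
set_option linter.dupNamespace false

noncomputable section

open scoped Classical

open CategoryTheory NumberField IsDedekindDomain Field PowerSeries
  Literature.NumberTheory.EllipticCurves Literature.NumberTheory.EllipticCurves.GreenbergSelmer
  Literature.NumberTheory.GaloisRepresentations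
  Literature.NumberTheory.EllipticCurves.BigGaloisRep
  Literature.NumberTheory.EllipticCurves.BigRepModule
  Summit.BirchSwinnertonDyer.Rank1Residual.X11b

namespace Summit.BirchSwinnertonDyer.BirchSwinnertonDyer.Theorems.TelescopeK2MemberTransportCore

open Summit.BirchSwinnertonDyer.BirchSwinnertonDyer.Theorems

/-! ## §1 Scalar bookkeeping -/

section Semilinear

variable {S₁ S₂ : Type*} [CommRing S₁] [CommRing S₂] (σ : S₁ ≃+* S₂)
  {M : Type*} [AddCommGroup M] [Module S₁ M] {N : Type*} [AddCommGroup N] [Module S₂ N]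

/-- **Finite generation is transported along a semilinear equivalence over a ring isomorphism** (the images of generators
generate). [cite: BourbakiAC5to7, Ch. VII §4.4 (transport of structure)] -/
theorem moduleFinite_of_semilinearEquiv (e : M ≃+ N) (he : ∀ (r : S₁) (m : M), e (r • m) = σ r • e m)
    [Module.Finite S₁ M] : Module.Finite S₂ N := by
  haveI : RingHomSurjective (σ : S₁ →+* S₂) := ⟨σ.surjective⟩
  let f : M →ₛₗ[(σ : S₁ →+* S₂)] N :=
    { toFun := e
      map_add' := e.map_add
      map_smul' := fun r m => he r m }
  exact Module.Finite.of_surjective f e.surjective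

/-- **Torsion is transported along a semilinear equivalence over a ring isomorphism** (`σ` maps non-zero-divisors onto
non-zero-divisors). [cite: BourbakiAC5to7, Ch. VII §4.4 (transport of structure)] -/
theorem isTorsion_of_semilinearEquiv (e : M ≃+ N) (he : ∀ (r : S₁) (m : M), e (r • m) = σ r • e m)
    (hM : Module.IsTorsion S₁ M) : Module.IsTorsion S₂ N := by
  intro n
  obtain ⟨⟨r, hr⟩, hrm⟩ := @hM (e.symm n)
  have hσr : σ r ∈ nonZeroDivisors S₂ := by
    rw [← MulEquivClass.map_nonZeroDivisors σ]
    exact Submonoid.mem_map_of_mem _ hr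
  refine ⟨⟨σ r, hσr⟩, ?_⟩
  change (σ r) • n = 0
  change r • e.symm n = 0 at hrm
  rw [← e.apply_symm_apply n, ← he, hrm, map_zero]

end Semilinear

section Bounded

variable {Λ : Type*} [CommRing Λ] {P Q : Type*} [AddCommGroup P] [Module Λ P] [AddCommGroup Q] [Module Λ Q]

/-- **Torsion descends along a map whose kernel is killed by a non-zero-divisor**: if `g : P → Q` is linear, `s • ker g = 0` with
`s ∈ Λ⁰`, and `Q` is torsion, then `P` is torsion. [cite: GreenbergLNM1716, §4 (quasi-isomorphisms)] -/
theorem isTorsion_of_ker_smul (g : P →ₗ[Λ] Q) {s : Λ} (hs : s ∈ nonZeroDivisors Λ)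
    (hker : ∀ x : P, g x = 0 → s • x = 0) (hQ : Module.IsTorsion Λ Q) : Module.IsTorsion Λ P := by
  intro x
  obtain ⟨⟨d, hd⟩, hdx⟩ := @hQ (g x)
  refine ⟨⟨s * d, mul_mem hs hd⟩, ?_⟩
  change (s * d) • x = 0
  change d • g x = 0 at hdx
  rw [mul_smul]
  exact hker _ (by rw [map_smul, hdx])

/-- **Torsion ascends along a map whose cokernel is killed by a non-zero-divisor**: if `g : P → Q` is linear, `s • Q ⊆ range g` with
`s ∈ Λ⁰`, and `P` is torsion, then `Q` is torsion. [cite: GreenbergLNM1716, §4 (quasi-isomorphisms)] -/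
theorem isTorsion_of_smul_mem_range (g : P →ₗ[Λ] Q) {s : Λ} (hs : s ∈ nonZeroDivisors Λ)
    (hrange : ∀ y : Q, s • y ∈ LinearMap.range g) (hP : Module.IsTorsion Λ P) : Module.IsTorsion Λ Q := by
  intro y
  obtain ⟨x, hx⟩ := LinearMap.mem_range.1 (hrange y)
  obtain ⟨⟨d, hd⟩, hdx⟩ := @hP x
  refine ⟨⟨d * s, mul_mem hd hs⟩, ?_⟩
  change (d * s) • y = 0
  change d • x = 0 at hdx
  rw [mul_smul, ← hx, ← map_smul, hdx, map_zero]

end Bounded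

/-! ## §2 The big representation of the target with scalars restricted to `ℤ_p` -/

section RestrictScalars

variable {K : Type} [Field K] [NumberField K] {p : ℕ} [Fact p.Prime]
  {R : Type} [CommRing R] [Algebra ℤ_[p] R] [TopologicalSpace R]
  {C : Type} [AddCommGroup C] [Module R C] [Module ℤ_[p] C] [IsScalarTower ℤ_[p] R C]
  [TopologicalSpace C] [DiscreteTopology C]
  [TopologicalSpace (PowerSeries R)] [ContinuousSMul (PowerSeries R) (BigRepModule R p C)]
  [TopologicalSpace (PowerSeries ℤ_[p])] [ContinuousSMul (PowerSeries ℤ_[p]) (BigRepModule ℤ_[p] p C)]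

omit [NumberField K] [ContinuousSMul (PowerSeries R) (BigRepModule R p C)]
  [ContinuousSMul (PowerSeries ℤ_[p]) (BigRepModule ℤ_[p] p C)] in
/-- **`C ⊗ Λ_{ℤ_p}^* ≃ₜ+ C ⊗ Λ_R^*` for `ρ_C|ℤ_p` and `ρ_C`, equivariant and semilinear.** The identity on smooth `p`-primary maps
`ℤ_p → C` (`BigRepModule.restrictScalarsEquiv`) intertwines `bigRep κ (ρ_C|ℤ_p)` with `bigRep κ ρ_C` and carries `t • Φ` to
`(PowerSeries.map (algebraMap ℤ_p R) t) • Φ`. [cite: Skinner2016PacificMC, §2.3 (p. 179)] [cite: Castella2018, §2.1] -/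
theorem exists_bigRep_restrictScalars_addEquiv (κ : absoluteGaloisGroup K →ₜ* Multiplicative ℤ_[p])
    (ρC : ContinuousRep (absoluteGaloisGroup K) R C) :
    ∃ η : BigRepModule ℤ_[p] p C ≃ₜ+ BigRepModule R p C,
      (∀ (Φ : BigRepModule ℤ_[p] p C) (x : ℤ_[p]), η Φ x = Φ x) ∧
      (∀ (g : absoluteGaloisGroup K) (Φ : BigRepModule ℤ_[p] p C),
          η (bigRep (p := p) κ (ρC.restrictScalars ℤ_[p]) g Φ) = bigRep (p := p) κ ρC g (η Φ)) ∧
      (∀ (t : PowerSeries ℤ_[p]) (Φ : BigRepModule ℤ_[p] p C),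
          η (t • Φ) = algebraMap (PowerSeries ℤ_[p]) (PowerSeries R) t • η Φ) := by
  let rse : BigRepModule R p C ≃+ BigRepModule ℤ_[p] p C := BigRepModule.restrictScalarsEquiv ℤ_[p]
  let η : BigRepModule ℤ_[p] p C ≃ₜ+ BigRepModule R p C :=
    { rse.symm with continuous_toFun := continuous_of_discreteTopology, continuous_invFun := continuous_of_discreteTopology }
  have hη : ∀ (Φ : BigRepModule ℤ_[p] p C) (x : ℤ_[p]), η Φ x = Φ x := fun _ _ => rfl
  have hrse : ∀ Φ : BigRepModule ℤ_[p] p C, rse (η Φ) = Φ := fun Φ => rse.apply_symm_apply Φ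
  refine ⟨η, hη, fun g Φ => ?_, fun t Φ => ?_⟩
  · ext x
    rw [hη, bigRep_apply_apply, bigRep_apply_apply, hη, ContinuousRep.restrictScalars_apply]
  · apply rse.injective
    rw [hrse, TelescopeK2TorsionBigRepIdentification.algebraMap_powerSeries_eq,
      BigRepModule.restrictScalarsEquiv_map_smul, hrse]

/-- **The dual Selmer groups of `ρ_C|ℤ_p ⊗ Λ^*` (a `Λ = ℤ_p⟦T⟧`-module) and of `ρ_C ⊗ Λ_R^*` (an `R⟦T⟧`-module) are identified by an
additive equivalence semilinear over `PowerSeries.map (algebraMap ℤ_p R)`**, for ANY family of local conditions `L` (Selmer groups do not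
see the ring of scalars: `TelescopeK2SelmerScalarTransport.exists_selmer_addEquiv`, dualised). [cite: Skinner2016PacificMC, §2.3 (p. 179)]
[cite: Brown1982CohomologyGroups, III.1 Example 3] -/
theorem exists_dual_selmer_addEquiv_restrictScalars (κ : absoluteGaloisGroup K →ₜ* Multiplicative ℤ_[p])
    (ρC : ContinuousRep (absoluteGaloisGroup K) R C) (L : Set (LocalIndex K)) :
    ∃ d : CharacterModule (TorsionControl.selmer (localMap K) L (bigRep (p := p) κ (ρC.restrictScalars ℤ_[p]))) ≃+
        CharacterModule (TorsionControl.selmer (localMap K) L (bigRep (p := p) κ ρC)),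
      ∀ (t : PowerSeries ℤ_[p])
        (ψ : CharacterModule (TorsionControl.selmer (localMap K) L (bigRep (p := p) κ (ρC.restrictScalars ℤ_[p])))),
        d (t • ψ) = PowerSeries.map (algebraMap ℤ_[p] R) t • d ψ := by
  obtain ⟨η, -, hηG, hησ⟩ := exists_bigRep_restrictScalars_addEquiv (p := p) κ ρC
  obtain ⟨e, he⟩ := TelescopeK2SelmerScalarTransport.exists_selmer_addEquiv (localMap K) L
    (bigRep (p := p) κ (ρC.restrictScalars ℤ_[p])) (bigRep (p := p) κ ρC)
    (algebraMap (PowerSeries ℤ_[p]) (PowerSeries R)) η hηG hησ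
  let d : CharacterModule (TorsionControl.selmer (localMap K) L (bigRep (p := p) κ (ρC.restrictScalars ℤ_[p]))) ≃+
      CharacterModule (TorsionControl.selmer (localMap K) L (bigRep (p := p) κ ρC)) :=
    { toFun := fun ψ => ψ.comp e.symm.toAddMonoidHom
      invFun := fun χ => χ.comp e.toAddMonoidHom
      left_inv := fun ψ => by ext s; change ψ (e.symm (e s)) = ψ s; rw [e.symm_apply_apply]
      right_inv := fun χ => by ext t; change χ (e (e.symm t)) = χ t; rw [e.apply_symm_apply]
      map_add' := fun ψ ψ' => by ext s; rfl }
  refine ⟨d, fun t ψ => ?_⟩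
  ext s
  change ψ (t • e.symm s) = ψ (e.symm (PowerSeries.map (algebraMap ℤ_[p] R) t • s))
  congr 1
  apply e.injective
  rw [he, e.apply_symm_apply, e.apply_symm_apply, TelescopeK2TorsionBigRepIdentification.algebraMap_powerSeries_eq]

end RestrictScalars

/-! ## §3 The member transport core -/

section Core

variable {K : Type} [Field K] [NumberField K] {p : ℕ} [Fact p.Prime]
  {𝒪 : Type} [CommRing 𝒪] [Algebra ℤ_[p] 𝒪] [TopologicalSpace 𝒪]
  {A : Type} [AddCommGroup A] [Module 𝒪 A] [Module ℤ_[p] A] [IsScalarTower ℤ_[p] 𝒪 A]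
  [TopologicalSpace A] [DiscreteTopology A]
  [TopologicalSpace (PowerSeries 𝒪)] [ContinuousSMul (PowerSeries 𝒪) (BigRepModule 𝒪 p A)]
  {R : Type} [CommRing R] [Algebra ℤ_[p] R] [TopologicalSpace R]
  {C : Type} [AddCommGroup C] [Module R C] [TopologicalSpace C] [DiscreteTopology C]
  [TopologicalSpace (PowerSeries R)] [ContinuousSMul (PowerSeries R) (BigRepModule R p C)]

set_option maxHeartbeats 1600000 in
/-- **THE MEMBER TRANSPORT CORE.** In the setting of the module docstring (`θ : A[c] →+ C` semilinear over a BIJECTIVE `ℤ_p → R`,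
`Γ_K`-equivariant for `torsionRep ρ c` and `ρ_C`, finite kernel and cokernel; `Y = Sel_{𝔮,∅}(K, M[C c])^∨` with any compatible
`Λ`-structure; `𝔛 = XBig κ ρ_C 𝔮 ∅`):
(i) `𝔛` is `R⟦T⟧`-torsion iff `Y` is `Λ`-torsion;
(ii) if `𝔛` and `Y` are finitely generated and `Y` is torsion then `(C (algebraMap ℤ_p R p^e)) · Ch_{R⟦T⟧}(𝔛) ⊆ σ(char_Λ Y)` for some `e`,
`σ = PowerSeries.map (algebraMap ℤ_p R)`.
(the transport half of N3′'s (ctrl_k) and of its torsion-transfer clause, generic coefficients). [cite: GreenbergLNM1716, §4]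
[cite: Skinner2016PacificMC, §2.3 (p. 179)] [cite: BourbakiAC5to7, Ch. VII §4.4–4.5] [cite: Castella2018, §2.1–2.2] -/
theorem memberTransport (κ : ZpExtension K p) (𝔮 : HeightOneSpectrum (𝓞 K))
    (ρ : ContinuousRep (absoluteGaloisGroup K) 𝒪 A) (c : 𝒪)
    (hR : Function.Bijective (algebraMap ℤ_[p] R))
    (ρC : ContinuousRep (absoluteGaloisGroup K) R C)
    (θ : Submodule.torsionBy 𝒪 A c →+ C)
    (hθC : ∀ (r : ℤ_[p]) (a : Submodule.torsionBy 𝒪 A c), θ (algebraMap ℤ_[p] 𝒪 r • a) = algebraMap ℤ_[p] R r • θ a)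
    (hθG : ∀ (g : absoluteGaloisGroup K) (a : Submodule.torsionBy 𝒪 A c),
      θ (TorsionControl.torsionRep ρ c g a) = ρC g (θ a))
    (hker : Finite θ.ker) (hcoker : Finite (C ⧸ θ.range))
    (hC : ∀ y : C, ∃ k : ℕ, p ^ k • y = 0)
    [Module (PowerSeries ℤ_[p]) (CharacterModule (TorsionControl.selmer (localMap K)
      (strictSet p 𝔮 (∅ : Set (HeightOneSpectrum (𝓞 K))))
      (TorsionControl.torsionRep (AnticyclotomicBigGaloisRep κ ρ) (PowerSeries.C c))))]
    [IsScalarTower (PowerSeries ℤ_[p]) (PowerSeries 𝒪) (CharacterModule (TorsionControl.selmer (localMap K)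
      (strictSet p 𝔮 (∅ : Set (HeightOneSpectrum (𝓞 K))))
      (TorsionControl.torsionRep (AnticyclotomicBigGaloisRep κ ρ) (PowerSeries.C c))))] :
    (Module.IsTorsion (PowerSeries R) (XBig κ ρC 𝔮 (∅ : Set (HeightOneSpectrum (𝓞 K)))) ↔
      Module.IsTorsion (PowerSeries ℤ_[p]) (CharacterModule (TorsionControl.selmer (localMap K)
        (strictSet p 𝔮 (∅ : Set (HeightOneSpectrum (𝓞 K))))
        (TorsionControl.torsionRep (AnticyclotomicBigGaloisRep κ ρ) (PowerSeries.C c))))) ∧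
    (Module.Finite (PowerSeries R) (XBig κ ρC 𝔮 (∅ : Set (HeightOneSpectrum (𝓞 K)))) →
      Module.Finite (PowerSeries ℤ_[p]) (CharacterModule (TorsionControl.selmer (localMap K)
        (strictSet p 𝔮 (∅ : Set (HeightOneSpectrum (𝓞 K))))
        (TorsionControl.torsionRep (AnticyclotomicBigGaloisRep κ ρ) (PowerSeries.C c)))) →
      Module.IsTorsion (PowerSeries ℤ_[p]) (CharacterModule (TorsionControl.selmer (localMap K)
        (strictSet p 𝔮 (∅ : Set (HeightOneSpectrum (𝓞 K))))
        (TorsionControl.torsionRep (AnticyclotomicBigGaloisRep κ ρ) (PowerSeries.C c)))) →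
      ∃ e : ℕ, Ideal.span {PowerSeries.C (algebraMap ℤ_[p] R ((p : ℤ_[p]) ^ e))} *
          XBig.charIdeal κ ρC 𝔮 (∅ : Set (HeightOneSpectrum (𝓞 K))) ≤
        (Literature.NumberTheory.EllipticCurves.Module.charIdeal (PowerSeries ℤ_[p])
          (CharacterModule (TorsionControl.selmer (localMap K)
            (strictSet p 𝔮 (∅ : Set (HeightOneSpectrum (𝓞 K))))
            (TorsionControl.torsionRep (AnticyclotomicBigGaloisRep κ ρ) (PowerSeries.C c))))).map
          (PowerSeries.map (algebraMap ℤ_[p] R))) := by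
  -- abbreviations
  set Ac : Type := ↥(Submodule.torsionBy 𝒪 A c)
  set Y : Type := CharacterModule (TorsionControl.selmer (localMap K)
      (strictSet p 𝔮 (∅ : Set (HeightOneSpectrum (𝓞 K))))
      (TorsionControl.torsionRep (AnticyclotomicBigGaloisRep κ ρ) (PowerSeries.C c)))
  set X : Type := XBig κ ρC 𝔮 (∅ : Set (HeightOneSpectrum (𝓞 K)))
  /- §a the `ℤ_p`-structure of `C` through `algebraMap ℤ_p R` -/
  letI instC : Module ℤ_[p] C := Module.compHom C (algebraMap ℤ_[p] R)
  haveI : IsScalarTower ℤ_[p] R C := IsScalarTower.of_algebraMap_smul fun _ _ => rfl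
  /- §b `θ` as a `ℤ_p`-linear map; kernel killed by `p^e₁`, cokernel by `p^e₂`; `A[c]` and `C` are `p`-primary -/
  let θ' : Ac →ₗ[ℤ_[p]] C :=
    { toFun := θ
      map_add' := θ.map_add
      map_smul' := fun r a => by
        rw [RingHom.id_apply, ← IsScalarTower.algebraMap_smul 𝒪 r a, hθC]
        rfl }
  have hθ' : ∀ a, θ' a = θ a := fun _ => rfl
  haveI : Finite (LinearMap.ker θ') := by
    have : (LinearMap.ker θ' : Set Ac) = (θ.ker : Set Ac) := by
      ext a
      change a ∈ LinearMap.ker θ' ↔ a ∈ θ.ker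
      rw [LinearMap.mem_ker, AddMonoidHom.mem_ker, hθ']
    exact Finite.of_equiv θ.ker (Equiv.setCongr this.symm)
  obtain ⟨e₁, he₁⟩ := TelescopeK2WeightTwoTransportCore.exists_pow_smul_eq_zero_of_finite (p := p) (F := LinearMap.ker θ')
  have hkerθ : ∀ a : Ac, θ' a = 0 → ((p : ℤ_[p]) ^ e₁) • a = 0 := fun a ha =>
    congrArg Subtype.val (he₁ ⟨a, ha⟩)
  haveI : Finite (C ⧸ LinearMap.range θ') := by
    have hr : (LinearMap.range θ').toAddSubgroup = θ.range := by
      ext y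
      change y ∈ LinearMap.range θ' ↔ y ∈ θ.range
      rw [LinearMap.mem_range, AddMonoidHom.mem_range]
      exact ⟨fun ⟨a, ha⟩ => ⟨a, ha⟩, fun ⟨a, ha⟩ => ⟨a, ha⟩⟩
    exact Finite.of_equiv (C ⧸ θ.range) (QuotientAddGroup.quotientAddEquivOfEq hr.symm).toEquiv
  obtain ⟨e₂, he₂⟩ := TelescopeK2WeightTwoTransportCore.exists_pow_smul_eq_zero_of_finite (p := p) (F := C ⧸ LinearMap.range θ')
  have hcokerθ : ∀ y : C, ∃ a : Ac, θ' a = ((p : ℤ_[p]) ^ e₂) • y := fun y => by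
    have h := he₂ (Submodule.Quotient.mk y)
    rwa [← Submodule.Quotient.mk_smul, Submodule.Quotient.mk_eq_zero] at h
  -- `A[c]` is `p`-primary (through `θ` and the `p`-primary `C`)
  have hAc : ∀ a : Ac, ∃ k : ℕ, p ^ k • a = 0 := fun a => by
    obtain ⟨k, hk⟩ := hC (θ' a); refine ⟨k + e₁, ?_⟩
    have h1 : θ' (((p : ℤ_[p]) ^ k) • a) = 0 := by
      rw [map_smul]
      change (algebraMap ℤ_[p] R ((p : ℤ_[p]) ^ k)) • θ' a = 0
      rw [map_pow, map_natCast, ← Nat.cast_pow, Nat.cast_smul_eq_nsmul, hk]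
    have h2 := hkerθ _ h1
    rw [← mul_smul, ← pow_add, add_comm] at h2
    rwa [← Nat.cast_smul_eq_nsmul ℤ_[p], Nat.cast_pow]
  /- §c the `ℤ_p`-linear representations `ρ₀` on `A[c]` and `ρ_C|ℤ_p` on `C` -/
  haveI : ContinuousSMul ℤ_[p] Ac := SigmaLocal.continuousSMul_padicInt_of_discrete hAc
  let ρ₀ : ContinuousRep (absoluteGaloisGroup K) ℤ_[p] Ac :=
    (TorsionControl.torsionRep ρ c).restrictScalars ℤ_[p]
  have hρ₀ : ∀ (g : absoluteGaloisGroup K) (a : Ac), ((ρ₀ g a : Ac) : A) = ρ g a := fun g a => rfl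
  let ρCℤ : ContinuousRep (absoluteGaloisGroup K) ℤ_[p] C := ρC.restrictScalars ℤ_[p]
  have hθG' : ∀ (g : absoluteGaloisGroup K) (a : Ac), θ' (ρ₀ g a) = ρCℤ g (θ' a) := fun g a => hθG g a
  /- §d `Λ = ℤ_p⟦T⟧` with the discrete topology; the four bricks and §2 -/
  letI τΛ : TopologicalSpace (PowerSeries ℤ_[p]) := ⊥
  haveI : DiscreteTopology (PowerSeries ℤ_[p]) := ⟨rfl⟩
  obtain ⟨f, -, hfker, hfcoker⟩ :=
    TelescopeK2BigRepTransfer.exists_hom_bigRep_of_coefficients (p := p) κ.toContinuousMonoidHom ρ₀ ρCℤ θ' hθG'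
      (c₁ := (p : ℤ_[p]) ^ e₁) (c₂ := (p : ℤ_[p]) ^ e₂) hkerθ hcokerθ hAc
  obtain ⟨β, -, hβker, hβcoker⟩ :=
    TelescopeK2CohomologyTransfer.exists_dual_selmer_transfer (localMap K)
      (strictSet p 𝔮 (∅ : Set (HeightOneSpectrum (𝓞 K)))) f hfker hfcoker
  obtain ⟨η, -, hηG, hησ⟩ :=
    TelescopeK2TorsionBigRepIdentification.exists_torsion_bigRep_addEquiv (R := ℤ_[p]) (p := p)
      κ.toContinuousMonoidHom ρ c ρ₀ hρ₀
  obtain ⟨D⟩ := TelescopeK2SelmerScalarTransport.nonempty_dual_linearEquiv (localMap K)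
      (strictSet p 𝔮 (∅ : Set (HeightOneSpectrum (𝓞 K))))
      (bigRep (p := p) κ.toContinuousMonoidHom ρ₀)
      (TorsionControl.torsionRep (AnticyclotomicBigGaloisRep κ ρ) (PowerSeries.C c)) η hηG hησ
  obtain ⟨d, hd⟩ := exists_dual_selmer_addEquiv_restrictScalars (p := p) κ.toContinuousMonoidHom ρC
      (strictSet p 𝔮 (∅ : Set (HeightOneSpectrum (𝓞 K))))
  set Xℤ : Type := CharacterModule (TorsionControl.selmer (localMap K)
      (strictSet p 𝔮 (∅ : Set (HeightOneSpectrum (𝓞 K)))) (bigRep (p := p) κ.toContinuousMonoidHom ρCℤ))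
  set Y'' : Type := CharacterModule (TorsionControl.selmer (localMap K)
      (strictSet p 𝔮 (∅ : Set (HeightOneSpectrum (𝓞 K)))) (bigRep (p := p) κ.toContinuousMonoidHom ρ₀))
  let dX : Xℤ ≃+ X := d
  let σ : PowerSeries ℤ_[p] ≃+* PowerSeries R :=
    RingEquiv.ofBijective (PowerSeries.map (algebraMap ℤ_[p] R))
      ⟨PowerSeries.map_injective _ hR.1, PowerSeries.map_surjective _ hR.2⟩
  have hσ : (σ : PowerSeries ℤ_[p] →+* PowerSeries R) = PowerSeries.map (algebraMap ℤ_[p] R) :=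
    RingHom.ext fun _ => rfl
  have hdX : ∀ (t : PowerSeries ℤ_[p]) (ψ : Xℤ), dX (t • ψ) = σ t • dX ψ := fun t ψ => by
    show d (t • ψ) = PowerSeries.map (algebraMap ℤ_[p] R) t • d ψ
    exact hd t ψ
  have hdX' : ∀ (s : PowerSeries R) (χ : X), dX.symm (s • χ) = σ.symm s • dX.symm χ := fun s χ => by
    apply dX.injective
    rw [dX.apply_symm_apply, hdX, RingEquiv.apply_symm_apply, dX.apply_symm_apply]
  set a : PowerSeries ℤ_[p] := PowerSeries.C ((p : ℤ_[p]) ^ e₁) with ha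
  set b : PowerSeries ℤ_[p] := PowerSeries.C ((p : ℤ_[p]) ^ e₂) with hb
  have hab0 : a * b ≠ 0 := by
    rw [ha, hb, ← map_mul, ← pow_add]; intro h
    have h1 := congrArg (PowerSeries.constantCoeff (R := ℤ_[p])) h
    rw [PowerSeries.constantCoeff_C, map_zero] at h1
    exact pow_ne_zero _ (Nat.cast_ne_zero.mpr (Fact.out : p.Prime).ne_zero) h1
  have hab : a * b ∈ nonZeroDivisors (PowerSeries ℤ_[p]) := mem_nonZeroDivisors_of_ne_zero hab0
  -- torsion: `Y ↔ Y''` along `D`, `Y'' ↔ 𝔛_ℤ` along `β`, `𝔛_ℤ ↔ 𝔛` along `dX`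
  have hY_of_Y'' : Module.IsTorsion (PowerSeries ℤ_[p]) Y'' → Module.IsTorsion (PowerSeries ℤ_[p]) Y := fun h y => by
    obtain ⟨r, hr⟩ := @h (D y)
    exact ⟨r, D.injective (by rw [Submonoid.smul_def, map_smul, map_zero, ← Submonoid.smul_def, hr])⟩
  have hY''_of_Y : Module.IsTorsion (PowerSeries ℤ_[p]) Y → Module.IsTorsion (PowerSeries ℤ_[p]) Y'' := fun h y'' => by
    obtain ⟨r, hr⟩ := @h (D.symm y'')
    refine ⟨r, ?_⟩
    rw [Submonoid.smul_def, ← D.apply_symm_apply y'', ← map_smul, ← Submonoid.smul_def, hr, map_zero]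
  have htors_iff : Module.IsTorsion (PowerSeries R) X ↔ Module.IsTorsion (PowerSeries ℤ_[p]) Y := by
    constructor
    · exact fun hX => hY_of_Y'' (isTorsion_of_smul_mem_range β hab hβcoker
        (isTorsion_of_semilinearEquiv σ.symm dX.symm hdX' hX))
    · exact fun hY => isTorsion_of_semilinearEquiv σ dX hdX
        (isTorsion_of_ker_smul β (pow_mem hab 2) hβker (hY''_of_Y hY))
  refine ⟨htors_iff, fun hfgX hfgY htorY => ?_⟩
  haveI : Module.Finite (PowerSeries R) X := hfgX
  haveI : Module.Finite (PowerSeries ℤ_[p]) Y := hfgY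
  haveI : Module.Finite (PowerSeries ℤ_[p]) Xℤ := moduleFinite_of_semilinearEquiv σ.symm dX.symm hdX'
  haveI : Module.Finite (PowerSeries ℤ_[p]) Y'' := Module.Finite.equiv D
  have htorY'' : Module.IsTorsion (PowerSeries ℤ_[p]) Y'' := hY''_of_Y htorY
  have htorXℤ : Module.IsTorsion (PowerSeries ℤ_[p]) Xℤ := isTorsion_of_ker_smul β (pow_mem hab 2) hβker htorY''
  obtain ⟨e, he⟩ := TelescopeK2QuasiIsoCharIdeal.exists_span_pow_mul_charIdeal_le_of_smul_le_range
    htorXℤ htorY'' β hab0 hβcoker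
  -- `char Y'' ⊆ char Y` along the injective `D : Y → Y''`
  have hYY : Literature.NumberTheory.EllipticCurves.Module.charIdeal (PowerSeries ℤ_[p]) Y'' ≤
      Literature.NumberTheory.EllipticCurves.Module.charIdeal (PowerSeries ℤ_[p]) Y :=
    BiquadraticEisensteinDescentEisensteinHeartFlatCMInertBadKPrimeCharIdealBaseChange.charIdeal_le_of_injective
      htorY'' D.toLinearMap D.injective
  -- `Ch_{R⟦T⟧}(𝔛) = σ(char_Λ 𝔛_ℤ)`
  have hXX : Literature.NumberTheory.EllipticCurves.Module.charIdeal (PowerSeries R) X =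
      (Literature.NumberTheory.EllipticCurves.Module.charIdeal (PowerSeries ℤ_[p]) Xℤ).map
        (σ : PowerSeries ℤ_[p] →+* PowerSeries R) :=
    Literature.NumberTheory.EllipticCurves.Module.charIdeal_eq_map_of_semilinearEquiv σ dX hdX
  refine ⟨(e₁ + e₂) * e, ?_⟩
  have hx : (a * b) ^ e = PowerSeries.C ((p : ℤ_[p]) ^ ((e₁ + e₂) * e)) := by
    rw [ha, hb, ← map_mul, ← pow_add, ← map_pow, ← pow_mul]
  have hmapC : PowerSeries.C (algebraMap ℤ_[p] R ((p : ℤ_[p]) ^ ((e₁ + e₂) * e))) =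
      (σ : PowerSeries ℤ_[p] →+* PowerSeries R) ((a * b) ^ e) := by
    rw [hx, hσ, PowerSeries.map_C]
  have hXdef : XBig.charIdeal κ ρC 𝔮 (∅ : Set (HeightOneSpectrum (𝓞 K))) =
      Literature.NumberTheory.EllipticCurves.Module.charIdeal (PowerSeries R) X := rfl
  rw [hXdef, hXX, hmapC, ← Set.image_singleton, ← Ideal.map_span, ← Ideal.map_mul, ← hσ]
  exact Ideal.map_mono (le_trans he hYY)

end Core

end Summit.BirchSwinnertonDyer.BirchSwinnertonDyer.Theorems.TelescopeK2MemberTransportCore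

end
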